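import Summits.BirchSwinnertonDyer.Rank1Residual.Additive.PadicLogImage
import Literature.NumberTheory.EllipticCurves.Kato2004.LocPKummerLog
import Literature.NumberTheory.EllipticCurves.PadicFormalLogOrder
import HarnessLib

set_option autoImplicit false

/-!
# `p`-adic lattice algebra of `E(ℚ_p)` for the EXISTENCE of Kummer logarithms (display (4) LOG-EX of
# `KatoDescentRankOneCountContraOfFacts.lean`): a uniform bound `[E(ℚ_p) : p^k E(ℚ_p) + ℤ·P₀] ≤ C` and the
# gluing of `p`-adically compatible sequences of points (seat `bsd-cm-prr-ty1` g8, cell `bsd-cm`;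
# theorems only: no definition, no named fact, no instance, no `sorry`)

Part 1 of the seat's kernel proof of display (4) LOG-EX of stub 3 `stub_rankOneCountReadingKato` of the
Kato–Perrin-Riou skeletons v4 (cruxes stmt-BirchSwinnertonDyer-19945 `…/Lines/kato_perrin_riou_zp.lean`,
stmt-BirchSwinnertonDyer-19223 `…/Lines/kato_perrin_riou_istar.lean`; cell bsd-potss's held input 27322).
LOG-EX says: in analytic rank one every class of Kato's `H¹(ℤ[1/p], T_pW)` has a Kummer logarithm at `p`
(`Kato2004.HasLocPKummerLog`).  The proof (parts 2–3: `KatoDescentLocPKummerTower.lean`,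
`KatoDescentLocPKummerLogExistence.lean`) runs: Poitou–Tate relaxation bound at `v_p` (tree, cell b2b-bsdres,
`X11b.Relaxation.relIndex_selmerGroup_kummerOutside_le_of_facts`) + THIS FILE's uniform index bound ⟹ a
uniform multiple of the reductions `red_{p^k} x` is `p^k`-Selmer ⟹ `loc_p` is levelwise a local Kummer class
`κ_k(Q_k)` ⟹ (tower) `Q_{k+1} ≡ Q_k (mod p^k)` ⟹ THIS FILE's gluing gives ONE point `Q`.

MATHEMATICS (Silverman AEC IV.6.4, VII.6.3: `E(ℚ_p) ≅ ℤ_p × (finite)` through the logarithm).  For an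
abelian group `G` with a homomorphism `λ : G → ℚ_p` whose kernel is FINITE (order `t`) and whose image is a
full `ℤ_p`-lattice `ℤ_p·ϖ`, `ϖ ≠ 0` — for `G = E(ℚ_p)` this is the tree's `Additive.LocalLog.padicLog`
(`ker_padicLog` = torsion, `range_padicLog_eq_span_zpow`, cell b2b-bsdres) —
* §1 (A) `exists_uniform_zsmul_eq_add`: if `λ P₀ ≠ 0` there is ONE integer `m ≠ 0` with
  `m•g ∈ ℤ·P₀ + p^k•G` for EVERY `k` and every `g` (`m = t·p^s`, `λ P₀ = u p^s ϖ`; digits of `p`-adic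
  integers `PadicInt.appr`); hence `[G : ℤP₀ + p^k G] ∣ [G : mG]` uniformly in `k`;
* §1 (C) `exists_glue`: if `Q_{k+1} − Q_k ∈ p^k G` for all `k` then ONE `Q ∈ G` has `t•(Q − Q_k) ∈ p^k G`
  for all `k` (`ℤ_p` is `p`-adically complete, Mathlib `IsAdicComplete (maximalIdeal ℤ_[p]) ℤ_[p]`);
* §2 the instance `G = W(ℚ_v)`, `v = primePlace p` the place of `ℚ` above `p`, `λ = log ∘ (W(ℚ_v) ≅ W(ℚ_p))`:
  `exists_uniform_index_dvd` and `exists_glue_adicCompletion` (finiteness of `W(ℚ_v)/m` = Milne ADT I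
  Lemma 3.3, tree `finite_quotient_range_nsmul_adicCompletion`).

HONEST LABEL: unconditional TOOL theorems about local points; no stub or item is closed; nothing is asserted on
19945 / 19223; BSD is not proved for any curve.

References: [SilvermanAEC2009] IV.6.4, VII.6.3; [MilneADT2006] I Lemma 3.3; [BlochKato1990] Ex. 3.11
(`H¹_f(ℚ_p, V) =` Kummer image, `E(ℚ_p) ⊗ ℚ_p`); [Kato2004Asterisque] §14.9 (14.9.3) (p. 240).
-/

noncomputable section

open scoped Classical NumberField

namespace Summit.BirchSwinnertonDyer.Rank1Residual.Additive.LocPKummer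

/-! ## §1 Abstract lattice algebra: a homomorphism to `ℚ_p` with finite kernel and image `ℤ_p·ϖ` -/

section Lattice

variable {p : ℕ} [Fact p.Prime] {G : Type*} [AddCommGroup G] (lam : G →+ ℚ_[p]) {ϖ : ℚ_[p]}

/-- Coordinates: if `im λ = ℤ_p·ϖ` then every value `λ g` is `a·ϖ` for a (unique when `ϖ ≠ 0`) `p`-adic
integer `a`. [folklore] -/
theorem exists_coe_mul_eq (hrange : lam.range = (Submodule.span ℤ_[p] {ϖ}).toAddSubgroup) (g : G) :
    ∃ a : ℤ_[p], (a : ℚ_[p]) * ϖ = lam g := by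
  have h : lam g ∈ (Submodule.span ℤ_[p] {ϖ}).toAddSubgroup := hrange ▸ ⟨g, rfl⟩
  rw [Submodule.mem_toAddSubgroup, Submodule.mem_span_singleton] at h
  obtain ⟨a, ha⟩ := h
  exact ⟨a, by rw [← ha, Algebra.smul_def, PadicInt.algebraMap_apply]⟩

/-- Conversely every `a·ϖ`, `a ∈ ℤ_p`, is a value of `λ`. [folklore] -/
theorem exists_apply_eq_coe_mul (hrange : lam.range = (Submodule.span ℤ_[p] {ϖ}).toAddSubgroup) (a : ℤ_[p]) :
    ∃ h : G, lam h = (a : ℚ_[p]) * ϖ := by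
  have h : (a : ℚ_[p]) * ϖ ∈ lam.range := by
    rw [hrange, Submodule.mem_toAddSubgroup, Submodule.mem_span_singleton]
    exact ⟨a, by rw [Algebra.smul_def, PadicInt.algebraMap_apply]⟩
  obtain ⟨h, hh⟩ := h
  exact ⟨h, hh⟩

/-- A finite kernel is killed by its order: `#ker λ • g = 0` for `g ∈ ker λ`. [folklore] -/
theorem natCard_ker_nsmul_eq_zero [Finite lam.ker] {g : G} (hg : lam g = 0) :
    Nat.card lam.ker • g = 0 := by
  have h := card_nsmul_eq_zero' (x := (⟨g, hg⟩ : lam.ker))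
  exact congrArg Subtype.val h

/-- **(A) A uniform multiple into `ℤ·P₀ + p^k·G`.**  If `ker λ` is finite, `im λ = ℤ_p·ϖ` with `ϖ ≠ 0`,
and `λ P₀ ≠ 0`, then there is ONE integer `m ≠ 0` such that for EVERY `k` and every `g ∈ G`:
`m • g = c • P₀ + p^k • h` for some INTEGER `c` and some `h ∈ G`.  (`λ P₀ = a₀ ϖ`, `a₀ = u·p^s` with `u` a
unit; `m = #ker λ · p^s`; for `λ g = a ϖ` write `a u⁻¹ = c + p^k r` with `c ∈ ℕ` the `k`-th digit
approximation `PadicInt.appr`; then `λ(p^s g − c P₀ − p^k h) = 0` with `λ h = r a₀ ϖ`, and the finite kernel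
is killed by its order.) [cite: SilvermanAEC2009, IV.6.4 and VII.6.3] -/
theorem exists_uniform_zsmul_eq_add [Finite lam.ker]
    (hrange : lam.range = (Submodule.span ℤ_[p] {ϖ}).toAddSubgroup) {P₀ : G} (hP₀ : lam P₀ ≠ 0) :
    ∃ m : ℕ, m ≠ 0 ∧ ∀ (k : ℕ) (g : G), ∃ (c : ℤ) (h : G), (m : ℤ) • g = c • P₀ + ((p : ℤ) ^ k) • h := by
  have hp : p.Prime := Fact.out
  obtain ⟨a₀, ha₀⟩ := exists_coe_mul_eq lam hrange P₀
  have ha₀0 : a₀ ≠ 0 := by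
    rintro rfl
    rw [PadicInt.coe_zero, zero_mul] at ha₀
    exact hP₀ ha₀.symm
  -- `a₀ = u * p^s`
  set s : ℕ := a₀.valuation with hs
  set u : ℤ_[p]ˣ := PadicInt.unitCoeff ha₀0 with hu
  have ha₀eq : a₀ = (u : ℤ_[p]) * (p : ℤ_[p]) ^ s := PadicInt.unitCoeff_spec ha₀0
  set t : ℕ := Nat.card lam.ker with ht
  have ht0 : t ≠ 0 := Nat.card_pos.ne'
  refine ⟨t * p ^ s, Nat.mul_ne_zero ht0 (pow_ne_zero s hp.ne_zero), fun k g => ?_⟩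
  obtain ⟨a, ha⟩ := exists_coe_mul_eq lam hrange g
  -- digits: `a u⁻¹ = c + p^k r`
  set b : ℤ_[p] := a * (u⁻¹ : ℤ_[p]ˣ) with hb
  set c : ℕ := b.appr k with hc
  obtain ⟨r, hr⟩ : ∃ r : ℤ_[p], b - c = r * (p : ℤ_[p]) ^ k := by
    have h := PadicInt.appr_spec k b
    rw [Ideal.mem_span_singleton'] at h
    obtain ⟨r, hr⟩ := h
    exact ⟨r, hr.symm⟩
  -- the correcting point `h` with `λ h = r a₀ ϖ`
  obtain ⟨h, hh⟩ := exists_apply_eq_coe_mul lam hrange (r * a₀)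
  -- `λ (p^s • g - c • P₀ - p^k • h) = 0`
  have hker : lam (((p : ℤ) ^ s) • g - (c : ℤ) • P₀ - ((p : ℤ) ^ k) • h) = 0 := by
    rw [map_sub, map_sub, map_zsmul, map_zsmul, map_zsmul, ← ha, ← ha₀, hh]
    have hbu : a = b * (u : ℤ_[p]) := by rw [hb, mul_assoc, Units.inv_mul, mul_one]
    have hbc : b = (c : ℤ_[p]) + r * (p : ℤ_[p]) ^ k := by rw [← hr]; ring
    rw [hbu, hbc, ha₀eq]
    push_cast
    simp only [zsmul_eq_mul]
    push_cast
    ring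
  -- kill the kernel
  have hkill := natCard_ker_nsmul_eq_zero lam hker
  rw [← ht] at hkill
  refine ⟨(t : ℤ) * c, t • h, ?_⟩
  have : (t : ℤ) • (((p : ℤ) ^ s) • g - (c : ℤ) • P₀ - ((p : ℤ) ^ k) • h) = 0 := by
    rw [natCast_zsmul]; exact hkill
  rw [zsmul_sub, zsmul_sub, sub_sub, sub_eq_zero, smul_smul, smul_smul] at this
  rw [show ((t * p ^ s : ℕ) : ℤ) = (t : ℤ) * (p : ℤ) ^ s by push_cast; ring, this, ← natCast_zsmul h t,
    smul_comm (t : ℤ) ((p : ℤ) ^ k) h]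

/-- **(A′) The uniform index bound.** Under the hypotheses of (A): `[G : ℤ·P₀ + p^k·G]` divides `[G : m·G]`
for every `k`. [cite: SilvermanAEC2009, VII.6.3] -/
theorem index_zmultiples_sup_dvd [Finite lam.ker]
    (hrange : lam.range = (Submodule.span ℤ_[p] {ϖ}).toAddSubgroup) {P₀ : G} (hP₀ : lam P₀ ≠ 0) :
    ∃ m : ℕ, m ≠ 0 ∧ ∀ k : ℕ,
      (AddSubgroup.zmultiples P₀ ⊔ (zsmulAddGroupHom ((p : ℤ) ^ k) : G →+ G).range).index ∣
        (zsmulAddGroupHom (m : ℤ) : G →+ G).range.index := by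
  obtain ⟨m, hm0, hm⟩ := exists_uniform_zsmul_eq_add lam hrange hP₀
  refine ⟨m, hm0, fun k => AddSubgroup.index_dvd_of_le ?_⟩
  rintro _ ⟨g, rfl⟩
  obtain ⟨c, h, hh⟩ := hm k g
  rw [zsmulAddGroupHom_apply, hh]
  exact AddSubgroup.add_mem _ (AddSubgroup.mem_sup_left (AddSubgroup.zsmul_mem_zmultiples P₀ c))
    (AddSubgroup.mem_sup_right ⟨h, rfl⟩)

/-- Telescoping: consecutive congruences `a_{k+1} ≡ a_k (mod p^k)` give `a_n ≡ a_m (mod p^m)` for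
`m ≤ n`. [folklore] -/
theorem sub_mem_span_pow_of_succ {a : ℕ → ℤ_[p]}
    (ha : ∀ k, a (k + 1) - a k ∈ Ideal.span {(p : ℤ_[p]) ^ k}) {m n : ℕ} (hmn : m ≤ n) :
    a n - a m ∈ Ideal.span {(p : ℤ_[p]) ^ m} := by
  induction n, hmn using Nat.le_induction with
  | base => rw [sub_self]; exact Ideal.zero_mem _
  | succ n hmn ih =>
    have h1 : a (n + 1) - a n ∈ Ideal.span {(p : ℤ_[p]) ^ m} :=
      Ideal.span_singleton_le_span_singleton.mpr (pow_dvd_pow _ hmn) (ha n)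
    have : a (n + 1) - a m = (a (n + 1) - a n) + (a n - a m) := by ring
    rw [this]
    exact Ideal.add_mem _ h1 ih

/-- **`ℤ_p` is `p`-adically complete** (Mathlib's `IsAdicComplete (maximalIdeal ℤ_[p]) ℤ_[p]`, in the
`Ideal.span {p^k}` currency): a sequence with `a_{k+1} ≡ a_k (mod p^k)` has a limit `L ≡ a_k (mod p^k)` for
all `k`. [cite: SerreLocalFields1979, II §1 (completeness of `ℤ_p`)] -/
theorem exists_limit_of_succ {a : ℕ → ℤ_[p]} (ha : ∀ k, a (k + 1) - a k ∈ Ideal.span {(p : ℤ_[p]) ^ k}) :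
    ∃ L : ℤ_[p], ∀ k, L - a k ∈ Ideal.span {(p : ℤ_[p]) ^ k} := by
  have hprec : ∀ {m n : ℕ}, m ≤ n →
      a m ≡ a n [SMOD ((IsLocalRing.maximalIdeal ℤ_[p]) ^ m • ⊤ : Submodule ℤ_[p] ℤ_[p])] := by
    intro m n hmn
    simp only [← Ideal.one_eq_top, smul_eq_mul, mul_one, SModEq.sub_mem, PadicInt.maximalIdeal_eq_span_p,
      Ideal.span_singleton_pow]
    have h := sub_mem_span_pow_of_succ ha hmn
    rw [← neg_sub]
    exact Submodule.neg_mem _ h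
  obtain ⟨L, hL⟩ := IsPrecomplete.prec (IsAdicComplete.toIsPrecomplete (I := IsLocalRing.maximalIdeal ℤ_[p])
    (R := ℤ_[p])) hprec
  refine ⟨L, fun k => ?_⟩
  have h := hL k
  simp only [← Ideal.one_eq_top, smul_eq_mul, mul_one, SModEq.sub_mem, PadicInt.maximalIdeal_eq_span_p,
    Ideal.span_singleton_pow] at h
  rw [← neg_sub]
  exact Submodule.neg_mem _ h

/-- **(C) Gluing a `p`-adically compatible sequence.**  If `ker λ` is finite (order `t`) and `im λ = ℤ_p·ϖ`,
`ϖ ≠ 0`, then for every sequence `Q : ℕ → G` with `Q_{k+1} − Q_k ∈ p^k·G` there is ONE `Q∞ ∈ G` with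
`t • (Q∞ − Q_k) ∈ p^k·G` for every `k` (coordinates `λ Q_k = a_k ϖ` form a `p`-adic Cauchy sequence; its
limit is a value of `λ`; the defect lies in the finite kernel). [cite: SilvermanAEC2009, IV.6.4 and VII.6.3]
[cite: SerreLocalFields1979, II §1] -/
theorem exists_glue [Finite lam.ker] (hϖ : ϖ ≠ 0)
    (hrange : lam.range = (Submodule.span ℤ_[p] {ϖ}).toAddSubgroup) (Q : ℕ → G)
    (hQ : ∀ k, Q (k + 1) - Q k ∈ (zsmulAddGroupHom ((p : ℤ) ^ k) : G →+ G).range) :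
    ∃ Qinf : G, ∀ k,
      (Nat.card lam.ker : ℤ) • (Qinf - Q k) ∈ (zsmulAddGroupHom ((p : ℤ) ^ k) : G →+ G).range := by
  -- coordinates
  choose a ha using fun k => exists_coe_mul_eq lam hrange (Q k)
  have hinj : ∀ {x y : ℤ_[p]}, (x : ℚ_[p]) * ϖ = (y : ℚ_[p]) * ϖ → x = y := fun h =>
    PadicInt.ext (mul_right_cancel₀ hϖ h)
  -- `a (k+1) - a k ∈ (p^k)`
  have hsucc : ∀ k, a (k + 1) - a k ∈ Ideal.span {(p : ℤ_[p]) ^ k} := by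
    intro k
    obtain ⟨R, hR⟩ := hQ k
    obtain ⟨r, hr⟩ := exists_coe_mul_eq lam hrange R
    rw [Ideal.mem_span_singleton']
    refine ⟨r, hinj ?_⟩
    have h1 : lam (Q (k + 1) - Q k) = ((p : ℤ) ^ k : ℤ) • lam R := by rw [← hR, zsmulAddGroupHom_apply, map_zsmul]
    rw [map_sub, ← ha (k + 1), ← ha k, ← hr, zsmul_eq_mul] at h1
    push_cast at h1 ⊢
    linear_combination -h1
  obtain ⟨L, hL⟩ := exists_limit_of_succ hsucc
  obtain ⟨Qinf, hQinf⟩ := exists_apply_eq_coe_mul lam hrange L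
  refine ⟨Qinf, fun k => ?_⟩
  obtain ⟨r, hr⟩ := Ideal.mem_span_singleton'.mp (hL k)
  -- `λ (Qinf - Q k) = p^k • λ h`
  obtain ⟨h, hh⟩ := exists_apply_eq_coe_mul lam hrange r
  have hker : lam (Qinf - Q k - ((p : ℤ) ^ k) • h) = 0 := by
    rw [map_sub, map_sub, map_zsmul, hQinf, ← ha k, hh, zsmul_eq_mul]
    have : (L : ℚ_[p]) = (a k : ℚ_[p]) + (r : ℚ_[p]) * (p : ℚ_[p]) ^ k := by
      rw [← sub_eq_iff_eq_add', ← PadicInt.coe_sub, ← hr]; push_cast; ring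
    rw [this]; push_cast; ring
  have hkill := natCard_ker_nsmul_eq_zero lam hker
  refine ⟨Nat.card lam.ker • h, ?_⟩
  rw [zsmulAddGroupHom_apply]
  have : (Nat.card lam.ker : ℤ) • (Qinf - Q k - ((p : ℤ) ^ k) • h) = 0 := by
    rw [natCast_zsmul]; exact hkill
  rw [zsmul_sub, sub_eq_zero] at this
  rw [this, smul_comm, natCast_zsmul]

end Lattice

/-! ## §2 The instance `G = W(ℚ_v)`, `v` the place of `ℚ` above `p`, `λ = log ∘ (W(ℚ_v) ≅ W(ℚ_p))` -/

section Points

open WeierstrassCurve Literature.NumberTheory.EllipticCurves Literature.NumberTheory.EllipticCurves.Kato2004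
  IsDedekindDomain

variable (W : WeierstrassCurve ℚ) [W.IsElliptic] [W.IsGloballyMinimal] (p : ℕ) [Fact p.Prime]

/-- **The logarithm on `W(ℚ_v)`** read through `ℚ_v ≅ ℚ_p` (`v = primePlace p`): there is a homomorphism
`λ : W(ℚ_v) → ℚ_p` with FINITE kernel equal to the torsion (`Additive.LocalLog.ker_padicLog`, AEC IV.6.4 /
VII.6.3, transported along the injective `W(ℚ_v) → W(ℚ_p)`) and image a full lattice `ℤ_p·ϖ`, `ϖ ≠ 0`
(`Additive.LocalLog.range_padicLog_eq_span_zpow`; `W(ℚ_v) → W(ℚ_p)` is onto). [cite: SilvermanAEC2009, IV.6.4 and VII.6.3] -/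
theorem exists_lambda_adicCompletion :
    ∃ (lam : (W.baseChange ((primePlace p).adicCompletion ℚ)).toAffine.Point →+ ℚ_[p]) (ϖ : ℚ_[p]),
      ϖ ≠ 0 ∧ Finite lam.ker ∧ lam.range = (Submodule.span ℤ_[p] {ϖ}).toAddSubgroup ∧
        ∀ P, lam P = 0 ↔ IsOfFinAddOrder P := by
  let E := (primePlace p).adicCompletion ℚ
  let eqv := Padic.adicCompletionEquiv (R := 𝓞 ℚ) ⟨p, Fact.out⟩
  let e : E →ₐ[ℚ] ℚ_[p] := eqv.toAlgEquiv.symm.toAlgHom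
  let f : (W.baseChange E).toAffine.Point →+ (W.baseChange ℚ_[p]).toAffine.Point :=
    WeierstrassCurve.Affine.Point.map (W' := W) e
  have hf : Function.Injective f := WeierstrassCurve.Affine.Point.map_injective (W' := W) e
  have hfsurj : Function.Surjective f := by
    intro S
    refine ⟨WeierstrassCurve.Affine.Point.map (W' := W) (padicToAdic p) S, ?_⟩
    change WeierstrassCurve.Affine.Point.map e (WeierstrassCurve.Affine.Point.map (padicToAdic p) S) = S
    rw [WeierstrassCurve.Affine.Point.map_map]
    have hid : e.comp (padicToAdic p) = AlgHom.id ℚ ℚ_[p] := by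
      refine AlgHom.ext fun a ↦ ?_
      rw [AlgHom.comp_apply, padicToAdic_apply]
      exact eqv.symm_apply_apply a
    rw [hid]
    cases S <;> rfl
  set lam₀ := Additive.LocalLog.padicLog (W.baseChange ℚ_[p]) with hlam₀
  refine ⟨lam₀.comp f, (p : ℚ_[p]) ^ ((2 : ℤ) +
      padicValNat p (Nat.card (AddCommGroup.torsion (W.baseChange ℚ_[p]).toAffine.Point)) -
        padicValNat p ((W.baseChange ℚ_[p]).formalFiltration 2).index), zpow_ne_zero _
      (Nat.cast_ne_zero.mpr (Fact.out : p.Prime).ne_zero), ?_, ?_, ?_⟩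
  · -- finite kernel: it embeds into the torsion of `W(ℚ_p)`
    haveI := Additive.LocalLog.finite_torsion_point (W.baseChange ℚ_[p])
    let g : (lam₀.comp f).ker → AddCommGroup.torsion (W.baseChange ℚ_[p]).toAffine.Point :=
      fun x => ⟨f x.1, by
        have hx : lam₀ (f x.1) = 0 := x.2
        rw [← Additive.LocalLog.ker_padicLog]
        exact hx⟩
    have hg : Function.Injective g := by
      intro x y hxy
      apply Subtype.ext
      exact hf (congrArg Subtype.val hxy)
    exact Finite.of_injective g hg
  · rw [AddMonoidHom.range_comp, AddMonoidHom.range_eq_top.mpr hfsurj, ← AddMonoidHom.range_eq_map]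
    exact Additive.LocalLog.range_padicLog_eq_span_zpow (W.baseChange ℚ_[p])
  · intro P
    rw [AddMonoidHom.comp_apply, Additive.LocalLog.padicLog_eq_zero_iff]
    constructor
    · intro h
      obtain ⟨m, hm, hmX⟩ := isOfFinAddOrder_iff_nsmul_eq_zero.mp h
      exact isOfFinAddOrder_iff_nsmul_eq_zero.mpr ⟨m, hm, hf (by rw [map_nsmul, map_zero]; exact hmX)⟩
    · intro h
      obtain ⟨m, hm, hmX⟩ := isOfFinAddOrder_iff_nsmul_eq_zero.mp h
      exact isOfFinAddOrder_iff_nsmul_eq_zero.mpr ⟨m, hm, by rw [← map_nsmul, hmX, map_zero]⟩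

/-- **The uniform index bound on `W(ℚ_v)`.**  For a point `P₀ ∈ W(ℚ_v)` of infinite order there is ONE
`C ≠ 0` with `[W(ℚ_v) : ℤ·P₀ + p^k·W(ℚ_v)] ∣ C` for EVERY `k` (`C = [W(ℚ_v) : m W(ℚ_v)]`, finite and non-zero
by Milne ADT I Lemma 3.3 / AEC VII.6.3, tree `finite_quotient_range_nsmul_adicCompletion`).
[cite: SilvermanAEC2009, VII.6.3] [cite: MilneADT2006, I Lemma 3.3] -/
theorem exists_uniform_index_dvd {P₀ : (W.baseChange ((primePlace p).adicCompletion ℚ)).toAffine.Point}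
    (hP₀ : ¬ IsOfFinAddOrder P₀) :
    ∃ C : ℕ, C ≠ 0 ∧ ∀ k : ℕ,
      (AddSubgroup.zmultiples P₀ ⊔ (zsmulAddGroupHom ((p : ℤ) ^ k) :
        (W.baseChange ((primePlace p).adicCompletion ℚ)).toAffine.Point →+ _).range).index ∣ C := by
  obtain ⟨lam, ϖ, hϖ, hfin, hrange, hker⟩ := exists_lambda_adicCompletion W p
  haveI := hfin
  have hP₀' : lam P₀ ≠ 0 := fun h => hP₀ ((hker P₀).mp h)
  obtain ⟨m, hm0, hm⟩ := index_zmultiples_sup_dvd lam hrange hP₀'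
  refine ⟨(zsmulAddGroupHom (m : ℤ) :
      (W.baseChange ((primePlace p).adicCompletion ℚ)).toAffine.Point →+ _).range.index, ?_, hm⟩
  haveI := W.finite_quotient_range_nsmul_adicCompletion (primePlace p) hm0
  rw [zsmulAddGroupHom_natCast]
  exact AddSubgroup.index_ne_zero_of_finite

/-- **Gluing on `W(ℚ_v)`.**  For every sequence `Q_k ∈ W(ℚ_v)` with `Q_{k+1} − Q_k ∈ p^k W(ℚ_v)` there are ONE
`t ≠ 0` (the order of the torsion of `W(ℚ_v)`) and ONE point `Q∞` with `t•(Q∞ − Q_k) ∈ p^k W(ℚ_v)` for all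
`k` — the `p`-adic completeness of `E(ℚ_p) ≅ ℤ_p × (finite)`. [cite: SilvermanAEC2009, IV.6.4 and VII.6.3] -/
theorem exists_glue_adicCompletion
    (Q : ℕ → (W.baseChange ((primePlace p).adicCompletion ℚ)).toAffine.Point)
    (hQ : ∀ k, Q (k + 1) - Q k ∈ (zsmulAddGroupHom ((p : ℤ) ^ k) :
      (W.baseChange ((primePlace p).adicCompletion ℚ)).toAffine.Point →+ _).range) :
    ∃ (t : ℕ) (Qinf : (W.baseChange ((primePlace p).adicCompletion ℚ)).toAffine.Point), t ≠ 0 ∧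
      ∀ k, (t : ℤ) • (Qinf - Q k) ∈ (zsmulAddGroupHom ((p : ℤ) ^ k) :
        (W.baseChange ((primePlace p).adicCompletion ℚ)).toAffine.Point →+ _).range := by
  obtain ⟨lam, ϖ, hϖ, hfin, hrange, -⟩ := exists_lambda_adicCompletion W p
  haveI := hfin
  obtain ⟨Qinf, hQinf⟩ := exists_glue lam hϖ hrange Q hQ
  exact ⟨Nat.card lam.ker, Qinf, Nat.card_pos.ne', hQinf⟩

end Points

end Summit.BirchSwinnertonDyer.Rank1Residual.Additive.LocPKummer

end
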